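import Summits.NavierStokesRegularity.FunctionalMining.StretchingLaminateHolder
import Summits.NavierStokesRegularity.FunctionalMining.StretchingLowerCellular
import Summits.NavierStokesRegularity.FunctionalMining.NoGo.StretchingSupNotSharp
import Mathlib.Tactic.Linarith
import HarnessLib

/-!
# K1-Q1″ typed: the laminate constant `C_lam`, its unconditional window, and the two transfer nodes

Cell `pub-nsfunc` (host summit NavierStokesRegularity, topic `FunctionalMining`), dictionary seat gen 8.
**Search for candidate a priori estimates; no regularity claim.** Pure algebra over the lamination-tree
calculus of `StretchingLaminates` (aa) / `StretchingLaminateCalculus` (ac) / `StretchingLaminateHolder` (ad)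
plus two tree theorems about the field constant `C⋆ = stretchingSupConst` (`½ ≤ C⋆`, p208565;
`C⋆ < 2/√3`, p205451). Nothing is asserted about Navier–Stokes.

The bank seat's question K1-Q1″ (`K1Q1-LAMINATES.md` §7: "is `C_lam < 2/√3` certifiable, and is
`C_lam = C⋆`?") had no typed object. This file supplies it:

* `Laminate.RatioBound θ` — every valid rational lamination tree `𝒯` has `σ(𝒯) ≤ θ·√(M²(𝒯))·E(𝒯)`;
  `Laminate.laminateSupConst` — **`C_lam := inf {θ | RatioBound θ}`**, the tree-level twin of `C⋆`.
* UNCONDITIONAL kernel facts: `RatioBound (2/√3)` (the Hölder ceiling of (ad)), `RatioBound C_lam`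
  (the infimum is attained), `𝒯.cert r = true → r ≤ C_lam` (every bank certificate is a lower bound for
  `C_lam` with NO realization node — in particular `69/125 ≤ C_lam` from the bank's depth-4 tree, and
  `1279/2000 ≤ C_lam` once (ab) is imported), hence the window **`0.552 ≤ C_lam ≤ 2/√3`**.
* TRANSFER DOWN (one node): `LaminateRealization → RatioBound C⋆`, i.e. **`C_lam ≤ C⋆`**, and therefore
  `LaminateRealization → LaminateDeficit` where **`LaminateDeficit : ∃ θ < 2/√3, RatioBound θ`** is the
  typed form of "`C_lam < 2/√3`" (`laminateDeficit_iff`); stated with `∃ θ < 2/√3`, not a hand-picked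
  constant (crux-typing rule (iv)). A direct, realization-free proof of `LaminateDeficit` is OPEN: it is a
  rigidity statement about near-extremal finite laminates for the cubic functional `σ` (equality in the
  leafwise Hölder chain forces `|ω| = M`, `|S|² = M²/2`, `S ∝ diag(2,−1,−1)` in the frame of `ω` at every
  weighted leaf).
* TRANSFER UP (question, no belief recorded): **`LaminatesSharp : ∀ θ, RatioBound θ → StretchingSupBound θ`**
  ("laminate bounds are field bounds", i.e. `C⋆ ≤ C_lam`); with the realization node it gives
  `C_lam = C⋆` (`laminateSupConst_eq_of_sharp`). In general relaxation theory laminates need NOT exhaust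
  gradient Young measures (rank-one convexity ≠ quasiconvexity for maps into `ℝ³`, Šverák 1992; iterated
  laminates and the rank-one convex envelope: Kružík–Roubíček 2019 §4.6, Prop. 4.6.5, p. 218, and
  laminates as gradient Young measures p. 221), so `LaminatesSharp` is a genuine question about THIS
  functional, recorded by the bank as "may be strict in principle" (§7).

Dictionary reading: the K1-Q1 value question splits as `C_lam ≤ C⋆ < 2/√3` (first inequality = one node,
second = tree theorem) with `C_lam ∈ [0.552, 2/√3]` unconditionally (`[0.6395, 2/√3]` with (ab));
the bank's laminate search explores `C_lam` from below, the nogo/Hölder side bounds `C⋆` from above, and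
the two typed nodes `LaminateRealization` (down) / `LaminatesSharp` (up) are exactly what separates the
two constants. [ours; internal bookkeeping nodes, NOT literature facts — LEAN PLACEMENT RULE respected]
-/

noncomputable section

namespace Summit.NavierStokesRegularity.FunctionalMining

open Literature.Analysis Literature.Analysis.FunctionSpaces Literature.Analysis.FunctionSpaces.Torus
open Literature.Analysis.FluidPDE Literature.Analysis.FluidPDE.Torus

namespace Laminate

/-! ## 1. The ratio bound and the laminate constant -/

/-- `RatioBound θ`: every valid rational lamination tree satisfies `σ(𝒯) ≤ θ · √(M²(𝒯)) · E(𝒯)`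
(the tree-level analogue of `StretchingSupBound θ`, with `M(𝒯)² = max` leaf `|ω|²`, `E(𝒯) = ½ Σ μ|G|²`).
[ours; bookkeeping] -/
def RatioBound (θ : ℝ) : Prop :=
  ∀ T : Tree, T.valid = true → (T.sigma : ℝ) ≤ θ * Real.sqrt (T.vortSup : ℝ) * (T.energy : ℝ)

/-- The leaf maximum of `|ω|²` is non-negative on a valid tree. [ours; bookkeeping] -/
theorem Tree.vortSup_nonneg (T : Tree) (hT : T.valid = true) : 0 ≤ T.vortSup := by
  have h := Tree.vortSq_le_vortSupFrom T hT Grad.zero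
  have h0 : Grad.zero.vortSq = 0 := by
    simp [Grad.zero, Grad.vortSq, Grad.vort0, Grad.vort1, Grad.vort2]
  rw [h0] at h
  exact h

/-- Monotonicity of the ratio bound in `θ`. [ours; bookkeeping] -/
theorem RatioBound.mono {θ θ' : ℝ} (h : RatioBound θ) (hle : θ ≤ θ') : RatioBound θ' := by
  intro T hT
  have hE : (0 : ℝ) ≤ T.energy := by exact_mod_cast Tree.energy_nonneg_of_valid T hT
  have hX : 0 ≤ Real.sqrt (T.vortSup : ℝ) * (T.energy : ℝ) := mul_nonneg (Real.sqrt_nonneg _) hE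
  calc (T.sigma : ℝ) ≤ θ * Real.sqrt (T.vortSup : ℝ) * (T.energy : ℝ) := h T hT
    _ = θ * (Real.sqrt (T.vortSup : ℝ) * (T.energy : ℝ)) := mul_assoc _ _ _
    _ ≤ θ' * (Real.sqrt (T.vortSup : ℝ) * (T.energy : ℝ)) := mul_le_mul_of_nonneg_right hle hX
    _ = θ' * Real.sqrt (T.vortSup : ℝ) * (T.energy : ℝ) := (mul_assoc _ _ _).symm

/-- **The Hölder ceiling is a ratio bound: `RatioBound (2/√3)`** (from (ad) `Tree.abs_sigma_le_holder`
with `M = √(M²(𝒯))`). [ours] -/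
theorem ratioBound_holder : RatioBound (2 / Real.sqrt 3) := by
  intro T hT
  have h0 : (0 : ℝ) ≤ (T.vortSup : ℝ) := by exact_mod_cast Tree.vortSup_nonneg T hT
  have hsup : (T.vortSup : ℝ) ≤ Real.sqrt (T.vortSup : ℝ) ^ 2 := by rw [Real.sq_sqrt h0]
  exact (le_abs_self _).trans (Tree.abs_sigma_le_holder T hT (Real.sqrt_nonneg _) hsup)

/-- The board tree forces `θ ≥ 1/2` for any ratio bound (`σ = 1/4`, `E = 1/2`, `M² = 1`). [ours] -/
theorem half_le_of_ratioBound {θ : ℝ} (h : RatioBound θ) : 1 / 2 ≤ θ := by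
  have hb := h board (by decide +kernel)
  rw [board_sigma, board_energy, board_vortSup] at hb
  push_cast at hb
  rw [Real.sqrt_one] at hb
  linarith

/-- The set of valid ratio constants. [ours; bookkeeping] -/
def ratioValid : Set ℝ := {θ | RatioBound θ}

/-- **`C_lam`**, the laminate stretching constant: the infimum of the valid ratio constants over all
finite rational div-free lamination trees. [ours; bookkeeping] -/
def laminateSupConst : ℝ := sInf ratioValid

/-- `ratioValid` is non-empty (Hölder). [ours; bookkeeping] -/
theorem ratioValid_nonempty : ratioValid.Nonempty := ⟨_, ratioBound_holder⟩

/-- `ratioValid` is bounded below by `1/2` (board). [ours; bookkeeping] -/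
theorem bddBelow_ratioValid : BddBelow ratioValid := ⟨1 / 2, fun _ h => half_le_of_ratioBound h⟩

/-- A valid ratio constant bounds `C_lam` from above. [ours; bookkeeping] -/
theorem laminateSupConst_le_of_ratioBound {θ : ℝ} (h : RatioBound θ) : laminateSupConst ≤ θ :=
  csInf_le bddBelow_ratioValid h

/-- **`C_lam ≤ 2/√3`** (unconditional). [ours] -/
theorem laminateSupConst_le_holder : laminateSupConst ≤ 2 / Real.sqrt 3 :=
  laminateSupConst_le_of_ratioBound ratioBound_holder

/-- **`1/2 ≤ C_lam`** (unconditional; board). [ours] -/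
theorem half_le_laminateSupConst : 1 / 2 ≤ laminateSupConst :=
  le_csInf ratioValid_nonempty fun _ h => half_le_of_ratioBound h

/-- **`C_lam` is attained: `RatioBound C_lam`.** [ours] -/
theorem ratioBound_laminateSupConst : RatioBound laminateSupConst := by
  intro T hT
  have hE : (0 : ℝ) ≤ T.energy := by exact_mod_cast Tree.energy_nonneg_of_valid T hT
  obtain ⟨X, hX0, hX⟩ : ∃ X : ℝ, 0 ≤ X ∧ X = Real.sqrt (T.vortSup : ℝ) * (T.energy : ℝ) :=
    ⟨_, mul_nonneg (Real.sqrt_nonneg _) hE, rfl⟩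
  have hval : ∀ θ ∈ ratioValid, (T.sigma : ℝ) ≤ θ * X := fun θ hθ => by
    rw [hX, ← mul_assoc]; exact hθ T hT
  rw [mul_assoc, ← hX]
  rcases hX0.eq_or_lt with hX0' | hXpos
  · have h := hval _ ratioBound_holder
    rw [← hX0', mul_zero] at h ⊢
    exact h
  · exact (div_le_iff₀ hXpos).1 (le_csInf ratioValid_nonempty fun θ hθ => (div_le_iff₀ hXpos).2 (hval θ hθ))

/-- **Every lamination certificate bounds `C_lam` from below, UNCONDITIONALLY: `𝒯.cert r = true → r ≤ C_lam`.**
(Compare the assembly of (aa), `LaminateRealization → 𝒯.cert r → r ≤ C⋆`, which needs the node.) [ours] -/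
theorem le_laminateSupConst_of_cert (T : Tree) (r : ℚ) (hc : T.cert r = true) :
    ((r : ℚ) : ℝ) ≤ laminateSupConst := by
  simp only [Tree.cert, Bool.and_eq_true, decide_eq_true_eq] at hc
  obtain ⟨⟨⟨⟨⟨hv, hr⟩, hσ⟩, hE⟩, hM⟩, hineq⟩ := hc
  have hrR : (0 : ℝ) < r := by exact_mod_cast hr
  have hσR : (0 : ℝ) < T.sigma := by exact_mod_cast hσ
  have hER : (0 : ℝ) ≤ T.energy := by exact_mod_cast hE
  have hMR : (0 : ℝ) ≤ T.vortSup := by exact_mod_cast hM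
  have hineqR : (r : ℝ) * r * ((T.energy : ℝ) * T.energy) * T.vortSup ≤ (T.sigma : ℝ) * T.sigma := by
    exact_mod_cast hineq
  have hkey : (r : ℝ) * T.energy * Real.sqrt T.vortSup ≤ T.sigma := by
    have h1 : ((r : ℝ) * T.energy * Real.sqrt T.vortSup) ^ 2 ≤ (T.sigma : ℝ) ^ 2 := by
      have : ((r : ℝ) * T.energy * Real.sqrt T.vortSup) ^ 2
          = (r : ℝ) * r * ((T.energy : ℝ) * T.energy) * T.vortSup := by
        rw [mul_pow, mul_pow, Real.sq_sqrt hMR]; ring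
      rw [this, pow_two]; exact hineqR
    have h2 := Real.sqrt_le_sqrt h1
    rwa [Real.sqrt_sq (by positivity), Real.sqrt_sq hσR.le] at h2
  have hB := ratioBound_laminateSupConst T hv
  -- `X = E·√(M²) > 0` since `0 < σ ≤ C_lam · X`
  have hX0 : 0 ≤ (T.energy : ℝ) * Real.sqrt T.vortSup := mul_nonneg hER (Real.sqrt_nonneg _)
  have hC0 : 0 ≤ laminateSupConst := le_trans (by norm_num) half_le_laminateSupConst
  rcases hX0.eq_or_lt with hX0' | hXpos
  · exfalso
    have hB' : (T.sigma : ℝ) ≤ laminateSupConst * ((T.energy : ℝ) * Real.sqrt T.vortSup) := by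
      have e : laminateSupConst * Real.sqrt (T.vortSup : ℝ) * (T.energy : ℝ)
          = laminateSupConst * ((T.energy : ℝ) * Real.sqrt T.vortSup) := by ring
      rw [← e]; exact hB
    rw [← hX0', mul_zero] at hB'
    linarith
  · have h3 : (r : ℝ) * ((T.energy : ℝ) * Real.sqrt T.vortSup)
        ≤ laminateSupConst * ((T.energy : ℝ) * Real.sqrt T.vortSup) := by
      calc (r : ℝ) * ((T.energy : ℝ) * Real.sqrt T.vortSup) = (r : ℝ) * T.energy * Real.sqrt T.vortSup :=
            (mul_assoc _ _ _).symm
        _ ≤ T.sigma := hkey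
        _ ≤ laminateSupConst * Real.sqrt (T.vortSup : ℝ) * (T.energy : ℝ) := hB
        _ = laminateSupConst * ((T.energy : ℝ) * Real.sqrt T.vortSup) := by ring
    exact le_of_mul_le_mul_right h3 hXpos

/-- **`0.552 ≤ C_lam`, unconditionally** (the bank's depth-4 tree, certificate `69/125`). [ours] -/
theorem d4_le_laminateSupConst : (69 / 125 : ℝ) ≤ laminateSupConst := by
  have h := le_laminateSupConst_of_cert treeD4 (69 / 125) treeD4_cert
  push_cast at h
  exact h

/-- **The unconditional kernel window for the laminate constant: `0.552 ≤ C_lam ≤ 2/√3`.** [ours] -/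
theorem laminateSupConst_window :
    (69 / 125 : ℝ) ≤ laminateSupConst ∧ laminateSupConst ≤ 2 / Real.sqrt 3 :=
  ⟨d4_le_laminateSupConst, laminateSupConst_le_holder⟩

/-! ## 2. Transfer down (one node): field bounds are laminate bounds, `C_lam ≤ C⋆` -/

/-- **Given the realization node, every field constant is a laminate constant:
`LaminateRealization → 0 ≤ C → StretchingSupBound C → RatioBound C`.** Proof: for a valid tree with
`σ > 0` and every `δ > 0` the node gives a smooth div-free field with `|ω|² ≤ M²(1+δ)²`,
`(1−δ)σ ≤ P`, `ℰ ≤ (1+δ)E`; the field bound with `M' = √(M²)(1+δ)` yields `(1−δ)σ ≤ C·√(M²)·E·(1+δ)²`,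
and `δ → 0`. [ours] -/
theorem ratioBound_of_stretchingSupBound (h : LaminateRealization) {C : ℝ} (hC : 0 ≤ C)
    (hB : StretchingSupBound (d := Fin 3) C) : RatioBound C := by
  intro T hT
  have hE : (0 : ℝ) ≤ T.energy := by exact_mod_cast Tree.energy_nonneg_of_valid T hT
  have hM0 : (0 : ℝ) ≤ T.vortSup := by exact_mod_cast Tree.vortSup_nonneg T hT
  obtain ⟨S, hS0, hS2, hS⟩ : ∃ S : ℝ, 0 ≤ S ∧ S ^ 2 = (T.vortSup : ℝ) ∧ S = Real.sqrt (T.vortSup : ℝ) :=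
    ⟨_, Real.sqrt_nonneg _, Real.sq_sqrt hM0, rfl⟩
  rw [← hS]
  obtain ⟨A, hA0, hA⟩ : ∃ A : ℝ, 0 ≤ A ∧ A = C * S * (T.energy : ℝ) :=
    ⟨_, mul_nonneg (mul_nonneg hC hS0) hE, rfl⟩
  rw [← hA]
  rcases le_or_gt (T.sigma : ℝ) 0 with hσ | hσ
  · exact hσ.trans hA0
  have hσQ : 0 < T.sigma := by exact_mod_cast hσ
  -- for every `δ > 0`: `(1-δ)σ ≤ A(1+δ)²`
  have key : ∀ δ : ℝ, 0 < δ → (1 - δ) * (T.sigma : ℝ) ≤ A * (1 + δ) ^ 2 := by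
    intro δ hδ
    obtain ⟨F, hF, hdiv, hω, hP, hEns⟩ := h T hT hσQ δ hδ
    have hM' : 0 ≤ S * (1 + δ) := mul_nonneg hS0 (by linarith)
    have hω' : ∀ x, torusVorticitySqAt F x ≤ (S * (1 + δ)) ^ 2 := by
      intro x; rw [mul_pow, hS2]; exact hω x
    have hb := hB (by simp) F hF hdiv (S * (1 + δ)) hM' hω'
    calc (1 - δ) * (T.sigma : ℝ) ≤ enstrophyProduction F := hP
      _ ≤ C * (S * (1 + δ)) * torusEnstrophy F := hb
      _ ≤ C * (S * (1 + δ)) * ((1 + δ) * (T.energy : ℝ)) :=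
          mul_le_mul_of_nonneg_left hEns (mul_nonneg hC hM')
      _ = A * (1 + δ) ^ 2 := by rw [hA]; ring
  -- conclude `σ ≤ A` with `δ = (σ − A)/(2(σ + 3A))`
  refine not_lt.mp fun hlt => ?_
  have hden : (0 : ℝ) < 2 * ((T.sigma : ℝ) + 3 * A) := by linarith
  obtain ⟨δ, hδ⟩ : ∃ δ : ℝ, δ = ((T.sigma : ℝ) - A) / (2 * ((T.sigma : ℝ) + 3 * A)) := ⟨_, rfl⟩
  have hδ0 : 0 < δ := by rw [hδ]; exact div_pos (by linarith) hden
  have hδ1 : δ ≤ 1 / 2 := by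
    rw [hδ, div_le_iff₀ hden]; linarith
  have hδmul : δ * (2 * ((T.sigma : ℝ) + 3 * A)) = (T.sigma : ℝ) - A := by
    rw [hδ]; exact div_mul_cancel₀ _ hden.ne'
  have hk := key δ hδ0
  have hδsq : δ * δ ≤ δ * (1 / 2) := mul_le_mul_of_nonneg_left hδ1 hδ0.le
  have hAδ : A * (δ * δ) ≤ A * δ := by
    have : δ * δ ≤ δ := by linarith
    exact mul_le_mul_of_nonneg_left this hA0
  -- `σ − A ≤ δ(σ + 3A) = (σ − A)/2`, contradiction
  have h1 : (T.sigma : ℝ) - A ≤ δ * ((T.sigma : ℝ) + 3 * A) := by nlinarith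
  nlinarith

/-- **`LaminateRealization → RatioBound C⋆`** (with `½ ≤ C⋆`, p208565, for the sign and
`stretchingSupBound_const` for attainment). [ours] -/
theorem ratioBound_stretchingSupConst (h : LaminateRealization) :
    RatioBound (stretchingSupConst (d := Fin 3)) :=
  ratioBound_of_stretchingSupBound h (le_trans (by norm_num) CellularStretching.half_le_stretchingSupConst)
    stretchingSupBound_const

/-- **`LaminateRealization → C_lam ≤ C⋆`.** [ours] -/
theorem laminateSupConst_le_stretchingSupConst (h : LaminateRealization) :
    laminateSupConst ≤ stretchingSupConst (d := Fin 3) :=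
  laminateSupConst_le_of_ratioBound (ratioBound_stretchingSupConst h)

end Laminate

/-! ## 3. The typed nodes of K1-Q1″: strict tree-level deficit (down) and laminate sharpness (up) -/

/-- **K1-Q1″ (strict tree-level deficit), typed: `∃ θ < 2/√3, RatioBound θ`** — some constant STRICTLY
below Hölder's bounds every finite rational div-free lamination tree. Equivalent to `C_lam < 2/√3`
(`laminateDeficit_iff`); implied by the realization node (`laminateDeficit_of_realization`, through
`C⋆ < 2/√3`, p205451); a realization-free proof is OPEN (rigidity of near-extremal laminates). Expected
TRUE (bank numerics: best tree `0.6395 ≪ 1.1547`). [ours; internal node, not a literature fact] -/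
@[conjecture] def LaminateDeficit : Prop :=
  ∃ θ : ℝ, θ < 2 / Real.sqrt 3 ∧ Laminate.RatioBound θ

/-- **K1-Q1‴ (laminate sharpness), typed as a QUESTION — no belief recorded: `RatioBound θ → StretchingSupBound θ`
for every `θ`**, i.e. laminate bounds are field bounds (`C⋆ ≤ C_lam`). In general relaxation theory
laminates do not exhaust gradient Young measures (rank-one convex ≠ quasiconvex, Šverák 1992;
Kružík–Roubíček 2019 §4.6), so this may FAIL; the bank records "may be strict in principle" (§7).
[ours; internal node, not a literature fact] -/
@[conjecture] def LaminatesSharp : Prop :=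
  ∀ θ : ℝ, Laminate.RatioBound θ → StretchingSupBound (d := Fin 3) θ

namespace Laminate

/-- **`LaminateDeficit ↔ C_lam < 2/√3`.** [ours] -/
theorem laminateDeficit_iff : LaminateDeficit ↔ laminateSupConst < 2 / Real.sqrt 3 :=
  ⟨fun ⟨_, hθ, hR⟩ => (laminateSupConst_le_of_ratioBound hR).trans_lt hθ,
    fun h => ⟨_, h, ratioBound_laminateSupConst⟩⟩

/-- **`LaminateRealization → LaminateDeficit`** (one node: `C_lam ≤ C⋆ < 2/√3`). [ours] -/
theorem laminateDeficit_of_realization (h : LaminateRealization) : LaminateDeficit :=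
  ⟨_, not_stretchingSupSharp_iff.mp not_stretchingSupSharp_fin3, ratioBound_stretchingSupConst h⟩

/-- **`LaminatesSharp → C⋆ ≤ C_lam`.** [ours] -/
theorem stretchingSupConst_le_laminateSupConst_of_sharp (hs : LaminatesSharp) :
    stretchingSupConst (d := Fin 3) ≤ laminateSupConst :=
  stretchingSupConst_le
    (bddBelow_stretchingSupValid
      (CellularStretching.not_stretchingSupBound_of_lt_half (by norm_num : (1 : ℝ) / 4 < 1 / 2)))
    (hs _ ratioBound_laminateSupConst)

/-- **Both nodes ⇒ `C_lam = C⋆`** (the bank's laminate search then computes THE constant). [ours] -/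
theorem laminateSupConst_eq_of_sharp (h : LaminateRealization) (hs : LaminatesSharp) :
    laminateSupConst = stretchingSupConst (d := Fin 3) :=
  le_antisymm (laminateSupConst_le_stretchingSupConst h) (stretchingSupConst_le_laminateSupConst_of_sharp hs)

/-- **`LaminatesSharp → 0.552 ≤ C_lam ≤ C⋆`**: under sharpness alone (no realization) the laminate
certificates are still NOT lower bounds for `C⋆` — sharpness transfers bounds UP; recorded to prevent the
misreading. What sharpness gives is `C⋆ ≤ C_lam ≤ 2/√3`. [ours; bookkeeping] -/
theorem stretchingSupConst_le_holder_via_sharp (hs : LaminatesSharp) :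
    stretchingSupConst (d := Fin 3) ≤ laminateSupConst ∧ laminateSupConst ≤ 2 / Real.sqrt 3 :=
  ⟨stretchingSupConst_le_laminateSupConst_of_sharp hs, laminateSupConst_le_holder⟩

end Laminate

end Summit.NavierStokesRegularity.FunctionalMining

end
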